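import Summits.QuantumFields.YangMills.Theorems.UnitScaleTiltProp7Op137OfKernelRows
import Summits.QuantumFields.YangMills.Theorems.UnitScaleTiltProp7H1fNormOfSupLetters
import HarnessLib

/-!
# Route `UnitScaleTilt`, crux K1 «MinimiserStabilityRegPr» (stmt-QuantumFields-19200), EX rows `norm_Hπ` ∕ `norm_H₁` (VALUE half) — ★p1 g27 CHAIR WORD №33 (6):
# **N1-H's VALUE LETTER `hV` FOR `H = G Q_k† K⁻¹` FROM THE h133-CLASS KERNEL ROW OF `HT`, BY A COARSE ROW-SUM** — «`norm_Hπ` VALUE half ⟸ N1-H ✓p768666 ∘ (row-sum of the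
# h133-class kernel of `HT`)» (width seat `ym3-torus-px21` g15)

Cell `ym3-torus` (HUMAN RULING D-0037; rung R3 = SU(2) YM₃ on T³ — NOT d = 4, NOT infinite volume, NOT a mass gap, NOT Clay).  THEOREMS ONLY (0 `def`, 0 `sorry`, default heartbeats);
`--supports stmt-QuantumFields-19200 --as helper`; count-neutral.

WHAT.  cst-p1 g36's N1-H door ✓`Prop7H1fNormOfSupLetters.norm_H1f_apply_le_of_route_letters` (the (115)→sup door for `H1f`, i.e. the EX rows `norm_H₁`∕`norm_Hπ` at their slots) displays two
letters: the VALUE letter `hV : ∀ b bd, ‖toL2⁻¹(HT … Δx U₀ (toL2B b)) bd‖ ≤ M_V·‖b‖` and the GRADIENT letter `hG`.  The h133-class KERNEL ROW of `HT` — px10 g13's H-DOOR ✓p769611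
`kernelH_of_kinvRow_of_greenBlockSup`'s OUTPUT SHAPE `‖toL2⁻¹(HT(toL2B δ_yZ)) bd‖ ≤ C_H·e^{−a·tdist(B bd₋, ŷ)}·‖Z‖` (member, generic slot; family §4 there) — gives `hV` by the COARSE
ROW-SUM ✓`Prop7Op137OfKernelRows.sup_row_of_coarse_kernel_row` (three directions per coarse site × the coarse torus geometric series): `M_V := 3·C_H·(2(1+1∕a))³`.  SLOT-GENERIC
(`Δx` free: Π-slot `DeltaPiSlotP` for `norm_Hπ`, J-slot for `norm_H₁`), K-STOREY-AGNOSTIC (the kernel row is a displayed letter — member ⟸ ✓p769611, family ⟸ its §4).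
* §1 ★★ `hV_HT_of_kernelRow` — THE `hV` TEXT from the kernel row (the reading `Y ↦ (bd ↦ toL2⁻¹(HT(toL2B Y)) bd)` as an additive map, inline).
* §2 ★★ `norm_H1f_le_of_kernelRow_of_gradLetter` — the same composed with N1-H ✓`norm_H1f_apply_le_of_route_letters` BY NAME: `‖H1f … b‖ ≤ max M_V M_∇ · ‖b‖` the moment the
  gradient letter `hG` (DISPLAY class, №33) is fed.
HYP-SAT (★★OWNER RULING №42).  ONE displayed letter, the kernel row (class (1): inhabited at the member by ✓p769611 from {hKinv, hGblk} and at the η∕Π-slots by the D-files), plus `0 ≤ C_H`,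
`0 < a`; conclusion non-vacuous (at `b = 0` both sides vanish); nothing conclusion-shaped assumed.
HONEST SCOPE.  A 3-line Schur bookkeeping step; nothing of `h133`, `norm_Hπ`'s gradient half, `norm_G`, the EX rows, EX or the crux is proved here; the Yang–Mills mass gap is NOT proved.

References: T. Bałaban, CMP **99** (1985) 389–434 [Balaban1985BackgroundPropagators] ((3.133)–(3.134) p.422, (3.46)–(3.49) pp.398–399); CMP **96** (1984) 223–250 [Balaban1984PropagatorsII]
((2.61) p.234); CMP **102** (1985) 277–309 [Balaban1985Variational] ((103) p.293, (115)–(117) pp.294–295).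
-/

set_option autoImplicit false

noncomputable section

open scoped Matrix.Norms.L2Operator BigOperators InnerProductSpace ComplexConjugate

namespace Summit.QuantumFields.YangMills.Theorems.Prop7HTValueRowOfKernel

open Literature.MathematicalPhysics.QuantumFieldTheory.Balaban1983to89
open Literature.MathematicalPhysics.QuantumFieldTheory.Balaban1983to89.T3ContinuumYM3Torus
open T3PrintedRegularOrbits (sites_eq)
open T3LevelShift (siteShift)
open B5Eq118OneStroke (iterBlockOf)
open B11Eq103H1Complex (BondL2K)
open Summit.QuantumFields.YangMills.Theorems.Prop7SectET3Transport (periodsT3)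
open Summit.QuantumFields.YangMills.Theorems.Prop7SectET3HilbertLetters (W₂ toL2 toL2B)
open Summit.QuantumFields.YangMills.Theorems.Prop7SectET3CurvedPropagators (HT)
open Summit.QuantumFields.YangMills.Theorems.Prop7Op137OfKernelRows (sup_row_of_coarse_kernel_row)

variable (F : T3Family) (n K : ℕ) (h : n ≤ K) (c₀ cB a : ℝ) [Fact (0 < c₀)] [Fact (0 < cB)]
  (Δx : GaugeField (F.P K) 0 (Matrix.specialUnitaryGroup (Fin 2) ℂ) → (BondL2K ℂ 3 (periodsT3 F K) c₀ W₂ →ₗ[ℂ] BondL2K ℂ 3 (periodsT3 F K) c₀ W₂))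
  (U₀ : GaugeField (F.P K) 0 (Matrix.specialUnitaryGroup (Fin 2) ℂ))

/-! ## §1 The value letter from the kernel row -/

/-- ★★ **N1-H's VALUE LETTER `hV` FROM THE h133-CLASS KERNEL ROW OF `HT`**: if `‖toL2⁻¹(HT(toL2B δ_yZ)) bd‖ ≤ C_H·e^{−a·tdist(B bd₋, ŷ)}·‖Z‖` for all coarse bonds `y`, values `Z` and
fine bonds `bd` (`0 ≤ C_H`, `0 < a`), then `‖toL2⁻¹(HT(toL2B b)) bd‖ ≤ 3·C_H·(2(1+1∕a))³·‖b‖` for every coarse one-form `b` and bond `bd` — the coarse row-sum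
✓`sup_row_of_coarse_kernel_row` at the additive reading `b ↦ toL2⁻¹(HT(toL2B b))`. [cite: Balaban1985BackgroundPropagators, (3.133) p.422, (3.49) p.399; Balaban1984PropagatorsII, (2.61) p.234] -/
theorem hV_HT_of_kernelRow {CH δ : ℝ} (hCH : 0 ≤ CH) (hδ : 0 < δ)
    (hk : ∀ (y : PBond (F.P n) 0) (Z : Matrix (Fin 2) (Fin 2) ℂ) (bd : PBond (F.P K) 0),
      ‖(toL2 F K c₀).symm (HT F n K h c₀ cB a Δx U₀ (toL2B F n cB (Pi.single y Z))) bd‖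
        ≤ CH * Real.exp (-(δ * (Site.tdist (P := F.P K) (iterBlockOf (K - n) bd.src) (siteShift (sites_eq F n K h) y.src) : ℝ))) * ‖Z‖) :
    ∀ (b : PBond (F.P n) 0 → Matrix (Fin 2) (Fin 2) ℂ) (bd : PBond (F.P K) 0),
      ‖(toL2 F K c₀).symm (HT F n K h c₀ cB a Δx U₀ (toL2B F n cB b)) bd‖ ≤ 3 * CH * (2 * (1 + 1 / δ)) ^ 3 * ‖b‖ := by
  intro b bd
  -- the additive reading `Y ↦ toL2⁻¹(HT(toL2B Y))`
  let T : (PBond (F.P n) 0 → Matrix (Fin 2) (Fin 2) ℂ) →+ (PBond (F.P K) 0 → Matrix (Fin 2) (Fin 2) ℂ) :=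
    (((toL2 F K c₀).symm.toLinearMap ∘ₗ HT F n K h c₀ cB a Δx U₀) ∘ₗ (toL2B F n cB).toLinearMap).toAddMonoidHom
  have hT : ∀ Y, T Y = (toL2 F K c₀).symm (HT F n K h c₀ cB a Δx U₀ (toL2B F n cB Y)) := fun Y => rfl
  have := sup_row_of_coarse_kernel_row (F := F) (h := h) T hCH hδ (fun y Z bd' => by rw [hT]; exact hk y Z bd') b bd
  rwa [hT] at this

/-! ## §2 Composed with N1-H: the VALUE conjunct of the (115)→sup door -/

variable [Fact (0 < (F.L : ℝ))] [Fact (0 < ((F.L : ℝ)⁻¹) ^ (K - n))]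

/-- ★★ **THE VALUE HALF OF `norm_Hπ` ∕ `norm_H₁` FROM THE KERNEL ROW, IN N1-H's CURRENCY**: under the kernel row of §1 and ANY gradient letter `hG` (display class) with constant `M_∇`,
`‖H1f … Δx U₀ b‖ ≤ max (3·C_H·(2(1+1∕a))³) M_∇ · ‖b‖` — ✓`norm_H1f_apply_le_of_route_letters` fed with §1.  The Π-slot instance is the EX row `norm_Hπ`'s shape modulo `hG`.
[cite: Balaban1985Variational, (103) p.293, (115)–(117) pp.294–295; Balaban1985BackgroundPropagators, (3.133) p.422] -/
theorem norm_H1f_le_of_kernelRow_of_gradLetter {CH δ MG : ℝ} (hCH : 0 ≤ CH) (hδ : 0 < δ)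
    (hk : ∀ (y : PBond (F.P n) 0) (Z : Matrix (Fin 2) (Fin 2) ℂ) (bd : PBond (F.P K) 0),
      ‖(toL2 F K c₀).symm (HT F n K h c₀ cB a Δx U₀ (toL2B F n cB (Pi.single y Z))) bd‖
        ≤ CH * Real.exp (-(δ * (Site.tdist (P := F.P K) (iterBlockOf (K - n) bd.src) (siteShift (sites_eq F n K h) y.src) : ℝ))) * ‖Z‖)
    (hG : ∀ b : PBond (F.P n) 0 → Matrix (Fin 2) (Fin 2) ℂ,
      ‖B11Eq111FrakG.nabla115 (((F.L : ℝ)⁻¹) ^ (K - n)) (Prop7SectET3Transport.bgOfCfg F K U₀)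
          (fun q : B9SectCLatticeCarrier.Bond 3 (periodsT3 F K) => (toL2 F K c₀).symm (HT F n K h c₀ cB a Δx U₀ (toL2B F n cB b)) ((Prop7SectET3Transport.bondEquiv F K).symm q))‖ ≤ MG * ‖b‖)
    (b : PBond (F.P n) 0 → Matrix (Fin 2) (Fin 2) ℂ) :
    ‖Prop7SectET3CurvedPropagators.H1f F n K h c₀ cB a Δx U₀ b‖ ≤ max (3 * CH * (2 * (1 + 1 / δ)) ^ 3) MG * ‖b‖ :=
  Prop7H1fNormOfSupLetters.norm_H1f_apply_le_of_route_letters F n K h c₀ cB a Δx U₀ (by positivity)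
    (hV_HT_of_kernelRow F n K h c₀ cB a Δx U₀ hCH hδ hk) hG b

end Summit.QuantumFields.YangMills.Theorems.Prop7HTValueRowOfKernel

end
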